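import Mathlib
import HarnessLib
import Summits.HubbardSuperconductivity.HubbardSuperconductivity.Theorems.KLProgrammeKLRegimeWickCutoffLines

/-!
# Route `KLProgramme` — ENGINE child gen 5 (stmt-HubbardSuperconductivity-19918 `KLRegimeEngineV14`), stub `stub_engine_step_values`,
# conjunct (E2-v9): the FREQUENCY-RESOLVED Wick pair kernel (the rung array `K` of the ladder) and DIAGONAL LINES `diagContr`
# (E2-WICK-ROADMAP §5 (iii-c) step 2, model half — definitions; cell gate-hubbard-kl, seat p1 g9 = C1 BetaSplit lead lineage)

Two objects the three-channel reading of the Wick bubbles at the pair labels is stated with: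

* **`klWickPairKernel n Q`** — the quartic vertex function of the Wick-smeared action `𝒲_n` at the pair labels of `klWickPairAmplitude`
  with ARBITRARY internal Matsubara frequencies: a matrix on `TorusSite 2 L × MatsubaraIdx M` (index order `(in, out)` and carrier
  `momentum × frequency`, as the rung array `K : Matrix (TorusSite 2 L × F) (TorusSite 2 L × F) ℂ` of k3c1-p1's bridge
  `pairLadderStepAtV8_of_expansion` / `…_of_wickTower` with `F = MatsubaraIdx M`, external index `a₀ = omega0 M`):
  `K_n(Q)((k⃗,ω),(k⃗′,ω′)) = 𝒱₄(𝒲_n)(ψ̂⁺_{(ω′,k⃗′)↑}, ψ̂⁺_{(−ω′,Q−k⃗′)↓}, ψ̂⁻_{(−ω,Q−k⃗)↓}, ψ̂⁻_{(ω,k⃗)↑})`;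
  at the lowest frequencies it IS the Wick pair amplitude (`klWickPairKernel_omega0`, `rfl`).  The particle–particle colourings of the
  two-line Wick term at the pair labels read `−(K·diag(λ)·K)((k⃗,ω₀),(k⃗′,ω₀))` — the second-order term of the ladder `T_K = K(1 + diag z′ K)⁻¹`
  (sequel file `…WickBubbleChannels`).
* **`diagContr ℓ`** — the two-point function of a DIAGONAL LINE: it pairs only reciprocal labels `(ψ̂⁻_{pσ}, ψ̂⁺_{pσ})`, with the
  spin-independent value `ℓ p` (`−ℓ p` in the other orientation, `0` elsewhere).  Every line of the Wick-ordered step is diagonal,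
  `contr ℂ C = diagContr ℓ_C`: hard `C^K_{>Λ_n}`, slice `g_n`, soft `D_n` (`contr_klHardCov/klSliceCov/klSoftCov_eq_diagContr`, values from
  p495694's tables: `χ·βL²·ĝ_K`, `(χ_n − χ_{n−1})·βL²·ĝ_K`, `(1 − χ_n)·βL²·ĝ_K`); the LINE REDUCTION `sum_diagContr_mul`:
  `Σ_{X,Y} diagContr ℓ X Y · f X Y = Σ_{p,σ} ℓ p · (f ψ̂⁻_{pσ} ψ̂⁺_{pσ} − f ψ̂⁺_{pσ} ψ̂⁻_{pσ})`.

Definitions with bodies + `rfl`-level identifications; nothing about the model is asserted.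
-/

noncomputable section

namespace Summit.HubbardSuperconductivity.HubbardSuperconductivity.Theorems.KLRegimeWick

set_option linter.dupNamespace false -- summit = problem name (single-conjunct summit), D-0017

open Literature.MathematicalPhysics.QuantumLattice GrassmannAlgebra Finset Matrix
open Literature.Probability.LatticeModels
open Summit.HubbardSuperconductivity.HubbardSuperconductivity.Theorems.TwoPointAssembly
open Summit.HubbardSuperconductivity.HubbardSuperconductivity.Theorems.KLProgrammeLegKernels
open Summit.HubbardSuperconductivity.HubbardSuperconductivity.Theorems.KLRegimeSplit

section Model

variable (L M : ℕ) [NeZero L] [NeZero M]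

/-! ## §1 The frequency-resolved Wick pair kernel -/

/-- **The frequency-resolved Wick pair kernel** of the scale-`n` action at total lattice momentum `Q` (zero total frequency): for
`x = (k⃗, ω)` (incoming pair `(ω,k⃗)↑, (−ω, Q−k⃗)↓`) and `y = (k⃗′, ω′)` (outgoing pair),
`K_n(Q)(x, y) = 𝒱₄(𝒲_n)(ψ̂⁺_{(ω′,k⃗′)↑}, ψ̂⁺_{(−ω′,Q−k⃗′)↓}, ψ̂⁻_{(−ω,Q−k⃗)↓}, ψ̂⁻_{(ω,k⃗)↑})` — the label tuple of `klWickPairAmplitude` with the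
two external frequencies free (`−ω` is `Fin.rev` on `MatsubaraIdx`).  The rung array of the pair ladder at scale `n`. -/
def klWickPairKernel (β U μ : ℝ) (K : TrigPolyC4v) (n : ℕ) (Q : TorusSite 2 L) :
    Matrix (TorusSite 2 L × MatsubaraIdx M) (TorusSite 2 L × MatsubaraIdx M) ℂ :=
  Matrix.of fun x y =>
    vertexFn L M β (klWickAction L M β U μ K n) 4
      ![(((y.2, y.1), 0), 0), (((y.2.rev, Q - y.1), 1), 0), (((x.2.rev, Q - x.1), 1), 1), (((x.2, x.1), 0), 1)]

variable (β U μ : ℝ) (K : TrigPolyC4v)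

omit [NeZero M] in
/-- Entries of `klWickPairKernel`. -/
theorem klWickPairKernel_apply (n : ℕ) (Q : TorusSite 2 L) (x y : TorusSite 2 L × MatsubaraIdx M) :
    klWickPairKernel L M β U μ K n Q x y =
      vertexFn L M β (klWickAction L M β U μ K n) 4
        ![(((y.2, y.1), 0), 0), (((y.2.rev, Q - y.1), 1), 0), (((x.2.rev, Q - x.1), 1), 1), (((x.2, x.1), 0), 1)] := rfl

/-- **At the lowest frequencies the kernel is the Wick pair amplitude**: `K_n(Q)((k⃗,ω₀),(k⃗′,ω₀)) = 𝒞^W_n(Q; k⃗, k⃗′)`. -/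
theorem klWickPairKernel_omega0 (n : ℕ) (Q k k' : TorusSite 2 L) :
    klWickPairKernel L M β U μ K n Q (k, omega0 M) (k', omega0 M) = klWickPairAmplitude L M β U μ K n Q k k' := rfl

end Model

/-! ## §2 Diagonal lines -/

section Lines

variable (L M : ℕ)

/-- **The two-point function of a DIAGONAL LINE with values `ℓ`**: `diagContr ℓ (ψ̂⁻_{pσ}) (ψ̂⁺_{pσ}) = ℓ p`, `diagContr ℓ (ψ̂⁺_{pσ}) (ψ̂⁻_{pσ}) = −ℓ p`,
and `0` on every other pair of labels (charge index `0 ↦ ψ̂⁺`, `1 ↦ ψ̂⁻`).  A covariance `C` is a diagonal line when `contr ℂ C = diagContr ℓ`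
— true of every line of the Wick-ordered step (`contr_klHardCov_eq_diagContr` etc. below). -/
def diagContr (ℓ : FreqMomentum L M → ℂ) (X Y : HubbardFieldIdx L M) : ℂ :=
  if X.1 = Y.1 then (if X.2 = 1 ∧ Y.2 = 0 then ℓ X.1.1 else if X.2 = 0 ∧ Y.2 = 1 then -ℓ X.1.1 else 0) else 0

variable {L M}

/-- `diagContr ℓ (ψ̂⁻_{pσ}) (ψ̂⁺_{pσ}) = ℓ p`. -/
@[simp] theorem diagContr_minus_plus (ℓ : FreqMomentum L M → ℂ) (p : FreqMomentum L M) (σ : Fin 2) :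
    diagContr L M ℓ ((p, σ), 1) ((p, σ), 0) = ℓ p := by
  simp [diagContr]

/-- `diagContr ℓ (ψ̂⁺_{pσ}) (ψ̂⁻_{pσ}) = −ℓ p`. -/
@[simp] theorem diagContr_plus_minus (ℓ : FreqMomentum L M → ℂ) (p : FreqMomentum L M) (σ : Fin 2) :
    diagContr L M ℓ ((p, σ), 0) ((p, σ), 1) = -ℓ p := by
  simp [diagContr]

/-- Off the reciprocal pair (`ψ̂⁻` end): `diagContr ℓ (ψ̂⁻_{pσ}) Z = 0` for `Z ≠ ψ̂⁺_{pσ}`. -/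
theorem diagContr_minus_eq_zero (ℓ : FreqMomentum L M → ℂ) (p : FreqMomentum L M) (σ : Fin 2) {Z : HubbardFieldIdx L M}
    (hZ : Z ≠ ((p, σ), 0)) : diagContr L M ℓ ((p, σ), 1) Z = 0 := by
  rcases Z with ⟨q, c⟩
  unfold diagContr
  by_cases hq : ((p, σ) : FreqMomentum L M × Fin 2) = q
  · subst hq
    have hc : c ≠ 0 := fun h => hZ (by rw [h])
    simp [hc]
  · simp [hq]

/-- Off the reciprocal pair (`ψ̂⁺` end): `diagContr ℓ (ψ̂⁺_{pσ}) Y = 0` for `Y ≠ ψ̂⁻_{pσ}`. -/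
theorem diagContr_plus_eq_zero (ℓ : FreqMomentum L M → ℂ) (p : FreqMomentum L M) (σ : Fin 2) {Y : HubbardFieldIdx L M}
    (hY : Y ≠ ((p, σ), 1)) : diagContr L M ℓ ((p, σ), 0) Y = 0 := by
  rcases Y with ⟨q, c⟩
  unfold diagContr
  by_cases hq : ((p, σ) : FreqMomentum L M × Fin 2) = q
  · subst hq
    have hc : c ≠ 1 := fun h => hY (by rw [h])
    simp [hc]
  · simp [hq]

/-- A two-point function vanishing off the reciprocal pairs with spin-independent values `ℓ` IS `diagContr ℓ`. -/
theorem contr_eq_diagContr {C : Matrix (HubbardFieldIdx L M) (HubbardFieldIdx L M) ℂ} {ℓ : FreqMomentum L M → ℂ}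
    (h1 : ∀ (p : FreqMomentum L M) (σ : Fin 2) (Z : HubbardFieldIdx L M), Z ≠ ((p, σ), 0) → contr ℂ C ((p, σ), 1) Z = 0)
    (h0 : ∀ (p : FreqMomentum L M) (σ : Fin 2) (Y : HubbardFieldIdx L M), Y ≠ ((p, σ), 1) → contr ℂ C ((p, σ), 0) Y = 0)
    (hv : ∀ (p : FreqMomentum L M) (σ : Fin 2), contr ℂ C ((p, σ), 1) ((p, σ), 0) = ℓ p) :
    contr ℂ C = diagContr L M ℓ := by
  funext X Y
  rcases X with ⟨⟨p, σ⟩, c⟩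
  by_cases hc : c = 1
  · subst hc
    by_cases hY : Y = ((p, σ), 0)
    · subst hY; rw [hv, diagContr_minus_plus]
    · rw [h1 p σ Y hY, diagContr_minus_eq_zero ℓ p σ hY]
  · obtain rfl : c = 0 := by
      rcases Fin.exists_fin_two.mp ⟨c, rfl⟩ with h | h
      · exact h
      · exact absurd h hc
    by_cases hY : Y = ((p, σ), 1)
    · subst hY; rw [contr_swap, hv, diagContr_plus_minus]
    · rw [h0 p σ Y hY, diagContr_plus_eq_zero ℓ p σ hY]

/-- **The hard line `C^K_{>Λ_n}` is diagonal**, value `χ_{Λ_n}(p)·βL²·ĝ_K(p)`. -/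
theorem contr_klHardCov_eq_diagContr [NeZero L] {β : ℝ} (hβ : β ≠ 0) (μ : ℝ) (K : TrigPolyC4v) (n : ℕ) :
    contr ℂ (klHardCov L M β μ K n) =
      diagContr L M (fun p => (hubbardCutoffWeightCT L M β μ K (klScale klE0 n) p : ℂ) * (((β * (L : ℝ) ^ 2 : ℝ) : ℂ) * propCT L M β μ K p)) :=
  contr_eq_diagContr (fun p σ _ hZ => (contr_kl_minus_eq_zero β μ K n p σ hZ).1) (fun p σ _ hY => (contr_kl_plus_eq_zero β μ K n p σ hY).1)
    (fun p σ => contr_klHardCov_minus_plus hβ μ K n p σ)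

/-- **The slice line `g_n` is diagonal**, value `(χ_{Λ_n} − χ_{Λ_{n−1}})(p)·βL²·ĝ_K(p)`. -/
theorem contr_klSliceCov_eq_diagContr [NeZero L] {β : ℝ} (hβ : β ≠ 0) (μ : ℝ) (K : TrigPolyC4v) (n : ℕ) :
    contr ℂ (klSliceCov L M β μ K n) =
      diagContr L M (fun p =>
        ((hubbardCutoffWeightCT L M β μ K (klScale klE0 n) p - hubbardCutoffWeightCT L M β μ K (klScale klE0 (n - 1)) p : ℝ) : ℂ) *
          (((β * (L : ℝ) ^ 2 : ℝ) : ℂ) * propCT L M β μ K p)) :=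
  contr_eq_diagContr (fun p σ _ hZ => (contr_kl_minus_eq_zero β μ K n p σ hZ).2.1) (fun p σ _ hY => (contr_kl_plus_eq_zero β μ K n p σ hY).2.1)
    (fun p σ => contr_klSliceCov_minus_plus hβ μ K n p σ)

/-- **The soft line `D_n` is diagonal**, value `(1 − χ_{Λ_n}(p))·βL²·ĝ_K(p)`. -/
theorem contr_klSoftCov_eq_diagContr [NeZero L] {β : ℝ} (hβ : β ≠ 0) (μ : ℝ) (K : TrigPolyC4v) (n : ℕ) :
    contr ℂ (klSoftCov L M β μ K n) =
      diagContr L M (fun p => ((1 - hubbardCutoffWeightCT L M β μ K (klScale klE0 n) p : ℝ) : ℂ) * (((β * (L : ℝ) ^ 2 : ℝ) : ℂ) * propCT L M β μ K p)) :=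
  contr_eq_diagContr (fun p σ _ hZ => (contr_kl_minus_eq_zero β μ K n p σ hZ).2.2) (fun p σ _ hY => (contr_kl_plus_eq_zero β μ K n p σ hY).2.2)
    (fun p σ => contr_klSoftCov_minus_plus hβ μ K n p σ)

/-- Diagonal two-point functions subtract valuewise (`contr` is additive: differences / slices of diagonal lines are diagonal). -/
theorem diagContr_sub (ℓ ℓ' : FreqMomentum L M → ℂ) :
    (fun X Y => diagContr L M ℓ X Y - diagContr L M ℓ' X Y) = diagContr L M (fun p => ℓ p - ℓ' p) := by
  funext X Y
  unfold diagContr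
  split_ifs <;> ring

/-- **Line reduction**: against a diagonal line, a double label sum is a single sum over the line's frequency–momentum and spin, read in
both orientations: `Σ_{X,Y} diagContr ℓ X Y · f X Y = Σ_{p,σ} ℓ p · (f ψ̂⁻_{pσ} ψ̂⁺_{pσ} − f ψ̂⁺_{pσ} ψ̂⁻_{pσ})`. -/
theorem sum_diagContr_mul [NeZero L] (ℓ : FreqMomentum L M → ℂ) (f : HubbardFieldIdx L M → HubbardFieldIdx L M → ℂ) :
    ∑ X, ∑ Y, diagContr L M ℓ X Y * f X Y =
      ∑ p : FreqMomentum L M, ∑ σ : Fin 2, ℓ p * (f ((p, σ), 1) ((p, σ), 0) - f ((p, σ), 0) ((p, σ), 1)) := by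
  rw [Fintype.sum_prod_type, Fintype.sum_prod_type]
  refine Finset.sum_congr rfl fun p _ => Finset.sum_congr rfl fun σ _ => ?_
  rw [Fin.sum_univ_two,
    Finset.sum_eq_single ((p, σ), 1) (fun Y _ hY => by rw [diagContr_plus_eq_zero ℓ p σ hY, zero_mul]) (fun hY => absurd (mem_univ _) hY),
    Finset.sum_eq_single ((p, σ), 0) (fun Z _ hZ => by rw [diagContr_minus_eq_zero ℓ p σ hZ, zero_mul]) (fun hZ => absurd (mem_univ _) hZ),
    diagContr_plus_minus, diagContr_minus_plus]
  ring

end Lines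


end Summit.HubbardSuperconductivity.HubbardSuperconductivity.Theorems.KLRegimeWick

end
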